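import Mathlib
import Summits.PneNP.PneNP.Theorems.OverlapGapAlgebraNoStableSectionDefs

/-!
# Route OverlapGapAlgebra, crux `NoStableSection` (stmt-PneNP-2462), line `DartGame`:
# stub `stub_energyBound`, FIRST APPEARANCE and the position sums

Helper file for `stub_energyBound` (`OverlapGapAlgebraNoStableSectionEnergy`), in the vocabulary of
`OverlapGapAlgebraNoStableSectionDefs`.  For a position `i` and a rung `ℓ` write
`N i = patCount Y ℓ (column of i over rungs < ℓ)` and `M i = patCount Y (ℓ+1) (column over rungs ≤ ℓ)`,
so `1 ≤ M i ≤ N i`.  Grouping positions by their column: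
`∑_i -log (M i / N i) = n · condEnt Y ℓ` (`en_sum_neglog_ratio`, via `∑_i log N i = n log n - n H_ℓ`),
`∑_i N i / M i ≤ 2n` (`en_sum_inv_ratio_le`), `∑_{Y ℓ i = Y ℓ' i} N i / M i ≤ n` for `ℓ' < ℓ`
(`en_sum_inv_ratio_filter_le`).  FIRST APPEARANCE (`stub_energyFirstAppearance`, the registered
helper stub): `n^k + ∑_{ℓ=1}^k #{I : rung ℓ of I is new} ≤ energySum Y k`, since the new rungs of a
tuple `I` carry pairwise distinct patterns.
-/

namespace Summit.PneNP.PneNP.Cruxes.NoStableSection.DartGame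
set_option linter.dupNamespace false

open Finset Real

variable {n : ℕ}

/-- A position lies in its own pattern class: `1 ≤ patCount Y ℓ (column of i)`. -/
theorem en_patCount_self_pos (Y : ℕ → Fin n → Bool) (ℓ : ℕ) (i : Fin n) :
    0 < patCount Y ℓ (fun j : Fin ℓ => Y j i) := by
  unfold patCount
  exact Finset.card_pos.2 ⟨i, by simp⟩

/-- Refining the column by one more rung shrinks the class: `M i ≤ N i`. -/
theorem en_patCount_succ_le_self (Y : ℕ → Fin n → Bool) (ℓ : ℕ) (i : Fin n) :
    patCount Y (ℓ + 1) (fun j : Fin (ℓ + 1) => Y j i) ≤ patCount Y ℓ (fun j : Fin ℓ => Y j i) := by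
  unfold patCount
  refine Finset.card_le_card fun i' hi' => ?_
  simp only [Finset.mem_filter, Finset.mem_univ, true_and] at hi' ⊢
  funext j
  simpa using congrFun hi' j.castSucc

/-- `∑_i log N_ℓ(column of i) = ∑_ξ N_ℓ(ξ) log N_ℓ(ξ) = n log n - n · H_ℓ(Y)`. -/
theorem en_sum_log_patCount (Y : ℕ → Fin n → Bool) (ℓ : ℕ) (hn : 1 ≤ n) :
    ∑ i, Real.log (patCount Y ℓ (fun j : Fin ℓ => Y j i) : ℝ) =
      n * Real.log n - n * typeEnt Y ℓ := by
  have hnr : (n : ℝ) ≠ 0 := by exact_mod_cast (by omega : n ≠ 0)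
  rw [← Finset.sum_fiberwise' (univ : Finset (Fin n)) (fun i => fun j : Fin ℓ => Y j i)
    (fun ξ => Real.log (patCount Y ℓ ξ : ℝ))]
  simp only [Finset.sum_const, nsmul_eq_mul]
  change ∑ ξ : Fin ℓ → Bool, (patCount Y ℓ ξ : ℝ) * Real.log (patCount Y ℓ ξ) = _
  have hN : ∑ ξ : Fin ℓ → Bool, (patCount Y ℓ ξ : ℝ) = n := by exact_mod_cast sum_patCount Y ℓ
  unfold typeEnt
  calc ∑ ξ : Fin ℓ → Bool, (patCount Y ℓ ξ : ℝ) * Real.log (patCount Y ℓ ξ)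
      = ∑ ξ : Fin ℓ → Bool, ((patCount Y ℓ ξ : ℝ) * Real.log n -
          n * negMulLog ((patCount Y ℓ ξ : ℝ) / n)) := by
        refine Finset.sum_congr rfl fun ξ _ => ?_
        rcases Nat.eq_zero_or_pos (patCount Y ℓ ξ) with h0 | hpos
        · simp [h0, negMulLog]
        · have hN0 : (patCount Y ℓ ξ : ℝ) ≠ 0 := by exact_mod_cast hpos.ne'
          have hc : (n : ℝ) * ((patCount Y ℓ ξ : ℝ) / n) = patCount Y ℓ ξ := mul_div_cancel₀ _ hnr
          rw [negMulLog, Real.log_div hN0 hnr]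
          linear_combination (-(Real.log (patCount Y ℓ ξ : ℝ) - Real.log n)) * hc
    _ = n * Real.log n - n * ∑ ξ : Fin ℓ → Bool, negMulLog ((patCount Y ℓ ξ : ℝ) / n) := by
        rw [Finset.sum_sub_distrib, ← Finset.sum_mul, hN, ← Finset.mul_sum]

/-- `∑_i -log (M i / N i) = n · condEnt Y ℓ` (the conditional type entropy as an average
log-likelihood ratio over positions). -/
theorem en_sum_neglog_ratio (Y : ℕ → Fin n → Bool) (ℓ : ℕ) (hn : 1 ≤ n) :
    ∑ i, -Real.log ((patCount Y (ℓ + 1) (fun j : Fin (ℓ + 1) => Y j i) : ℝ) /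
        patCount Y ℓ (fun j : Fin ℓ => Y j i)) = n * condEnt Y ℓ := by
  have h1 := en_sum_log_patCount Y ℓ hn
  have h2 := en_sum_log_patCount Y (ℓ + 1) hn
  unfold condEnt
  calc ∑ i, -Real.log ((patCount Y (ℓ + 1) (fun j : Fin (ℓ + 1) => Y j i) : ℝ) /
          patCount Y ℓ (fun j : Fin ℓ => Y j i))
      = ∑ i, (Real.log (patCount Y ℓ (fun j : Fin ℓ => Y j i) : ℝ) -
          Real.log (patCount Y (ℓ + 1) (fun j : Fin (ℓ + 1) => Y j i) : ℝ)) := by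
        refine Finset.sum_congr rfl fun i _ => ?_
        rw [Real.log_div (by exact_mod_cast (en_patCount_self_pos Y (ℓ + 1) i).ne')
          (by exact_mod_cast (en_patCount_self_pos Y ℓ i).ne')]
        ring
    _ = (n * Real.log n - n * typeEnt Y ℓ) - (n * Real.log n - n * typeEnt Y (ℓ + 1)) := by
        rw [Finset.sum_sub_distrib, h1, h2]
    _ = n * (typeEnt Y (ℓ + 1) - typeEnt Y ℓ) := by ring

/-- Averaging a nonnegative class function with weights `1 / (class size)` over positions gives at
most its plain sum over classes: `∑_i g(col i) / M(col i) ≤ ∑_ξ g ξ`. -/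
theorem en_sum_div_patCount_le (Y : ℕ → Fin n → Bool) (m : ℕ) (g : (Fin m → Bool) → ℝ)
    (hg : ∀ ξ, 0 ≤ g ξ) :
    ∑ i, g (fun j : Fin m => Y j i) / (patCount Y m (fun j : Fin m => Y j i) : ℝ) ≤ ∑ ξ, g ξ := by
  rw [← Finset.sum_fiberwise' (univ : Finset (Fin n)) (fun i => fun j : Fin m => Y j i)
    (fun ξ => g ξ / (patCount Y m ξ : ℝ))]
  refine Finset.sum_le_sum fun ξ _ => ?_
  rw [Finset.sum_const, nsmul_eq_mul]
  change (patCount Y m ξ : ℝ) * (g ξ / patCount Y m ξ) ≤ g ξ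
  rcases Nat.eq_zero_or_pos (patCount Y m ξ) with h0 | hpos
  · simp [h0, hg ξ]
  · rw [mul_div_cancel₀ _ (by exact_mod_cast hpos.ne' : (patCount Y m ξ : ℝ) ≠ 0)]

/-- `∑_i N i / M i ≤ 2n`. -/
theorem en_sum_inv_ratio_le (Y : ℕ → Fin n → Bool) (ℓ : ℕ) :
    ∑ i, ((patCount Y (ℓ + 1) (fun j : Fin (ℓ + 1) => Y j i) : ℝ) /
        patCount Y ℓ (fun j : Fin ℓ => Y j i))⁻¹ ≤ 2 * n := by
  have key := en_sum_div_patCount_le Y (ℓ + 1) (fun ξ' => (patCount Y ℓ (Fin.init ξ') : ℝ))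
    (fun ξ' => Nat.cast_nonneg _)
  have hN : ∑ ξ : Fin ℓ → Bool, (patCount Y ℓ ξ : ℝ) = n := by exact_mod_cast sum_patCount Y ℓ
  have hlhs : ∀ i : Fin n, ((patCount Y (ℓ + 1) (fun j : Fin (ℓ + 1) => Y j i) : ℝ) /
        patCount Y ℓ (fun j : Fin ℓ => Y j i))⁻¹ =
      (patCount Y ℓ (Fin.init fun j : Fin (ℓ + 1) => Y j i) : ℝ) /
        patCount Y (ℓ + 1) (fun j : Fin (ℓ + 1) => Y j i) := fun i => by
    rw [inv_div]
    rfl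
  have hrhs : ∑ ξ' : Fin (ℓ + 1) → Bool, (patCount Y ℓ (Fin.init ξ') : ℝ) = 2 * n := by
    rw [sum_pattern_succ ℓ fun ξ' => (patCount Y ℓ (Fin.init ξ') : ℝ)]
    simp only [Fin.init_snoc]
    rw [← hN, Finset.mul_sum]
    exact Finset.sum_congr rfl fun ξ _ => by ring
  rw [Finset.sum_congr rfl fun i _ => hlhs i, ← hrhs]
  exact key

/-- `∑_{i : Y ℓ i = Y ℓ' i} N i / M i ≤ n` for an earlier rung `ℓ' < ℓ`. -/
theorem en_sum_inv_ratio_filter_le (Y : ℕ → Fin n → Bool) (ℓ : ℕ) {ℓ' : ℕ} (hℓ' : ℓ' < ℓ) :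
    ∑ i ∈ univ.filter (fun i => Y ℓ i = Y ℓ' i),
      ((patCount Y (ℓ + 1) (fun j : Fin (ℓ + 1) => Y j i) : ℝ) /
        patCount Y ℓ (fun j : Fin ℓ => Y j i))⁻¹ ≤ n := by
  rw [Finset.sum_filter]
  have key := en_sum_div_patCount_le Y (ℓ + 1)
    (fun ξ' => if ξ' (Fin.last ℓ) = ξ' (Fin.castSucc ⟨ℓ', hℓ'⟩) then
      (patCount Y ℓ (Fin.init ξ') : ℝ) else 0)
    (fun ξ' => by
      split_ifs
      · exact Nat.cast_nonneg _
      · exact le_rfl)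
  have hN : ∑ ξ : Fin ℓ → Bool, (patCount Y ℓ ξ : ℝ) = n := by exact_mod_cast sum_patCount Y ℓ
  calc ∑ i, (if Y ℓ i = Y ℓ' i then ((patCount Y (ℓ + 1) (fun j : Fin (ℓ + 1) => Y j i) : ℝ) /
          patCount Y ℓ (fun j : Fin ℓ => Y j i))⁻¹ else 0)
      = ∑ i, (if (fun j : Fin (ℓ + 1) => Y j i) (Fin.last ℓ) =
            (fun j : Fin (ℓ + 1) => Y j i) (Fin.castSucc ⟨ℓ', hℓ'⟩) then
          (patCount Y ℓ (Fin.init fun j : Fin (ℓ + 1) => Y j i) : ℝ) else 0) /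
          (patCount Y (ℓ + 1) (fun j : Fin (ℓ + 1) => Y j i) : ℝ) := by
        refine Finset.sum_congr rfl fun i _ => ?_
        by_cases h : Y ℓ i = Y ℓ' i
        · have h' : (fun j : Fin (ℓ + 1) => Y j i) (Fin.last ℓ) =
              (fun j : Fin (ℓ + 1) => Y j i) (Fin.castSucc ⟨ℓ', hℓ'⟩) := by simpa using h
          rw [if_pos h, if_pos h', inv_div]
          rfl
        · have h' : ¬ (fun j : Fin (ℓ + 1) => Y j i) (Fin.last ℓ) =
              (fun j : Fin (ℓ + 1) => Y j i) (Fin.castSucc ⟨ℓ', hℓ'⟩) := by simpa using h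
          rw [if_neg h, if_neg h', zero_div]
    _ ≤ ∑ ξ' : Fin (ℓ + 1) → Bool, (if ξ' (Fin.last ℓ) = ξ' (Fin.castSucc ⟨ℓ', hℓ'⟩) then
          (patCount Y ℓ (Fin.init ξ') : ℝ) else 0) := key
    _ = ∑ ξ : Fin ℓ → Bool,
          ((if (Fin.snoc ξ true : Fin (ℓ + 1) → Bool) (Fin.last ℓ) =
              (Fin.snoc ξ true : Fin (ℓ + 1) → Bool) (Fin.castSucc ⟨ℓ', hℓ'⟩) then
            (patCount Y ℓ (Fin.init (Fin.snoc ξ true : Fin (ℓ + 1) → Bool)) : ℝ) else 0) +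
          (if (Fin.snoc ξ false : Fin (ℓ + 1) → Bool) (Fin.last ℓ) =
              (Fin.snoc ξ false : Fin (ℓ + 1) → Bool) (Fin.castSucc ⟨ℓ', hℓ'⟩) then
            (patCount Y ℓ (Fin.init (Fin.snoc ξ false : Fin (ℓ + 1) → Bool)) : ℝ) else 0)) :=
        sum_pattern_succ ℓ fun ξ' => if ξ' (Fin.last ℓ) = ξ' (Fin.castSucc ⟨ℓ', hℓ'⟩) then
          (patCount Y ℓ (Fin.init ξ') : ℝ) else 0
    _ = ∑ ξ : Fin ℓ → Bool, (patCount Y ℓ ξ : ℝ) := by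
        refine Finset.sum_congr rfl fun ξ _ => ?_
        simp only [Fin.snoc_last, Fin.snoc_castSucc, Fin.init_snoc]
        cases ξ ⟨ℓ', hℓ'⟩ <;> simp
    _ = n := hN

/-- FIRST APPEARANCE, per tuple: the new rungs of `I` carry pairwise distinct patterns, so
`#{ℓ ≤ k : rung ℓ of I is new} ≤ |patternsAt Y k I|`. -/
theorem en_card_new_le_card_patternsAt {k : ℕ} (Y : ℕ → Fin n → Bool) (I : Fin k → Fin n) :
    (univ.filter fun ℓ : Fin (k + 1) =>
        ∀ ℓ' < (ℓ : ℕ), ¬ ∀ r, Y ℓ (I r) = Y ℓ' (I r)).card ≤ (patternsAt Y k I).card := by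
  classical
  unfold patternsAt
  have hinj : Set.InjOn (fun ℓ : Fin (k + 1) => fun r => Y ℓ (I r))
      ↑(univ.filter fun ℓ : Fin (k + 1) => ∀ ℓ' < (ℓ : ℕ), ¬ ∀ r, Y ℓ (I r) = Y ℓ' (I r)) := by
    intro a ha b hb hab
    simp only [Finset.coe_filter, Finset.mem_univ, true_and, Set.mem_setOf_eq] at ha hb
    by_contra hne
    rcases Nat.lt_or_gt_of_ne (fun h => hne (Fin.ext h)) with h | h
    · exact hb a h fun r => (congrFun hab r).symm
    · exact ha b h fun r => congrFun hab r
  rw [← Finset.card_image_of_injOn hinj]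
  exact Finset.card_le_card (Finset.image_subset_image (Finset.subset_univ _))

/-- FIRST APPEARANCE, summed: `n^k + ∑_{ℓ=1}^{k} #{I : rung ℓ of I is new} ≤ energySum Y k`. -/
theorem en_sum_card_new_le_energySum {k : ℕ} (Y : ℕ → Fin n → Bool) :
    n ^ k + ∑ j : Fin k, (univ.filter fun I : Fin k → Fin n =>
        ∀ ℓ' < (j : ℕ) + 1, ¬ ∀ r, Y ((j : ℕ) + 1) (I r) = Y ℓ' (I r)).card ≤ energySum Y k := by
  classical
  unfold energySum
  calc n ^ k + ∑ j : Fin k, (univ.filter fun I : Fin k → Fin n =>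
          ∀ ℓ' < (j : ℕ) + 1, ¬ ∀ r, Y ((j : ℕ) + 1) (I r) = Y ℓ' (I r)).card
      = ∑ ℓ : Fin (k + 1), (univ.filter fun I : Fin k → Fin n =>
          ∀ ℓ' < (ℓ : ℕ), ¬ ∀ r, Y ℓ (I r) = Y ℓ' (I r)).card := by
        rw [Fin.sum_univ_succ]
        congr 1
        have h0 : (univ.filter fun I : Fin k → Fin n => ∀ ℓ' < ((0 : Fin (k + 1)) : ℕ),
            ¬ ∀ r, Y ((0 : Fin (k + 1)) : ℕ) (I r) = Y ℓ' (I r)) = univ :=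
          Finset.filter_true_of_mem fun I _ ℓ' h => absurd h (by simp)
        rw [h0, Finset.card_univ, Fintype.card_fun, Fintype.card_fin, Fintype.card_fin]
    _ = ∑ ℓ : Fin (k + 1), ∑ I : Fin k → Fin n,
          (if ∀ ℓ' < (ℓ : ℕ), ¬ ∀ r, Y ℓ (I r) = Y ℓ' (I r) then 1 else 0) := by
        simp only [Finset.card_filter]
    _ = ∑ I : Fin k → Fin n, ∑ ℓ : Fin (k + 1),
          (if ∀ ℓ' < (ℓ : ℕ), ¬ ∀ r, Y ℓ (I r) = Y ℓ' (I r) then 1 else 0) := Finset.sum_comm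
    _ = ∑ I : Fin k → Fin n, (univ.filter fun ℓ : Fin (k + 1) =>
          ∀ ℓ' < (ℓ : ℕ), ¬ ∀ r, Y ℓ (I r) = Y ℓ' (I r)).card := by
        simp only [Finset.card_filter]
    _ ≤ ∑ I : Fin k → Fin n, (patternsAt Y k I).card :=
        Finset.sum_le_sum fun I _ => en_card_new_le_card_patternsAt Y I

/-- FIRST APPEARANCE in ∀-closed form, verbatim the helper stub `stub_energyFirstAppearance`
registered on stmt-PneNP-2462 (line `DartGame`, used by `stub_energyBound`). -/
theorem stub_energyFirstAppearance : ∀ (n k : ℕ) (Y : ℕ → Fin n → Bool),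
    n ^ k + ∑ j : Fin k, (Finset.univ.filter fun I : Fin k → Fin n =>
      ∀ ℓ' < (j : ℕ) + 1, ¬ ∀ r, Y ((j : ℕ) + 1) (I r) = Y ℓ' (I r)).card ≤ energySum Y k :=
  fun _n _k Y => en_sum_card_new_le_energySum Y

/-- `∑_{j<k} (1 - A - (j+1) θ) = k (1 - A) - θ k(k+1)/2`. -/
theorem en_sum_fin_linear (k : ℕ) (A θ : ℝ) :
    ∑ j : Fin k, (1 - A - (((j : ℕ) + 1 : ℕ) : ℝ) * θ) =
      k * (1 - A) - θ * ((k : ℝ) * (k + 1) / 2) := by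
  induction k with
  | zero => simp
  | succ k ih =>
    rw [Fin.sum_univ_castSucc]
    simp only [Fin.val_castSucc, Fin.val_last] at ih ⊢
    rw [ih]
    push_cast
    ring

end Summit.PneNP.PneNP.Cruxes.NoStableSection.DartGame
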